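import Mathlib.FieldTheory.KummerExtension
import Mathlib.RingTheory.RootsOfUnity.Complex
import Mathlib.Analysis.SpecialFunctions.Arcosh
import Mathlib.Analysis.SpecialFunctions.Complex.Log
import HarnessLib

/-!
# The finite product `Π_{j<N} (2cosh μ − 2cos(a + 2πj/N)) = 2cosh(Nμ) − 2cos(Na)` and the transfer trick
# `(∀ T, Π_j (2cosh(T ũ_j) − 2) ≤ Π_j (2cosh(T u_j) − 2)) ⇒ Σ ũ ≤ Σ u`
# (bricks for the TORON MINIMALITY of the lattice zero-point energy — VALLEY term of both COARSE lanes of S-BASE,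
# crux `TwistedTraceScaling` stmt-QuantumFields-20203; design note `pub/ym-fleet/ym-luscher-20007-p1/COARSE-DESIGN.md` §12)

In the harmonic (Gaussian) model of the fixed-lattice transfer kernel near a FLAT connection the top eigenvalue is a product over the normal
modes of the (twisted) stiff Hessian `H_θ` of the factors `√(π/b)·(1 + κa + √((κa)² + 2κa))^{−1/2}` (`a` an eigenvalue of `H_θ`, tree
`TwoLattice.Stiff.stiff_groundState` / `Literature.…GaussianTransferKernelFrame`), i.e. `e^{−½ arcosh(1 + κa)}` per mode.  The VALLEY estimate of
COARSE-UPPER / the H-SUP of COARSE-LOWER needs the comparison of `Σ_modes ½arcosh(1 + κ a(θ))` at a non-trivial flat background (adjoint holonomy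
phases `α`) with its value at the torons: the charged modes have `a = Σ_k (2 − 2cos(p_k + α_k))`, `p ∈ (2π/L)ℤ_L³`.  This file supplies the
two elementary tools of that comparison (file `…ToronMinimality`):

* §1 ★ `prod_two_cosh_sub_two_cos`: `Π_{j<N} (2cosh μ − 2cos(a + 2πj/N)) = 2cosh(Nμ) − 2cos(Na)` (cyclotomic factorisation `1 − z^N = Π (1 − ζ^j z)`
  at `z = e^{−μ+ia}`), hence §2 ★ `prod_mass_add_twoSubTwoCos_ge`: for a mass `c ≥ 0` the twisted massive 1D determinant
  `Π_{j<N} (c + 2 − 2cos(a + 2πj/N))` is MINIMAL at zero twist, and `prod_range_twoMul_add_eq`: `Π_{i<T}(2y + 2 − 2cos(2πi/T)) = 2cosh(T·arcosh(1+y)) − 2`;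
* §3 ★ `sum_le_sum_of_prod_cosh_le`: if `Π_j (2cosh(T ũ_j) − 2) ≤ Π_j (2cosh(T u_j) − 2)` for every `T ∈ ℕ_{>0}` (`ũ > 0`, `u ≥ 0`), then
  `Σ ũ ≤ Σ u` — determinant inequalities in one extra (temporal) lattice direction of every length `T` give the zero-point-energy inequality
  without a limit.

HONEST FRAMING: elementary real/complex analysis; no lattice gauge theory object appears here; femto rung R2b1 (brick for a stub of a child of a
CONDITIONAL route); not a gap, not Clay.
-/

set_option autoImplicit false

noncomputable section

open Finset
open scoped BigOperators

namespace Summit.QuantumFields.YangMills.Theorems.FemtoTransferGap.TwoLattice.Toron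

/-! ## §1 The product formula -/

/-- `normSq (1 − r·e^{ix}) = 1 − 2r cos x + r²` for real `r`. [folklore] -/
theorem normSq_one_sub_ofReal_mul_exp (r x : ℝ) :
    Complex.normSq (1 - (r : ℂ) * Complex.exp (x * Complex.I)) = 1 - 2 * r * Real.cos x + r ^ 2 := by
  have hre : (1 - (r : ℂ) * Complex.exp (x * Complex.I)).re = 1 - r * Real.cos x := by
    simp [Complex.exp_ofReal_mul_I_re]
  have him : (1 - (r : ℂ) * Complex.exp (x * Complex.I)).im = -(r * Real.sin x) := by
    simp [Complex.exp_ofReal_mul_I_im]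
  rw [Complex.normSq_apply, hre, him]
  have h2 : Real.sin x ^ 2 + Real.cos x ^ 2 = 1 := Real.sin_sq_add_cos_sq x
  have : (1 - r * Real.cos x) * (1 - r * Real.cos x) + -(r * Real.sin x) * -(r * Real.sin x) =
      1 - 2 * r * Real.cos x + r ^ 2 * (Real.sin x ^ 2 + Real.cos x ^ 2) := by ring
  rw [this, h2, mul_one]

/-- `2cosh μ − 2cos x = e^{μ}·|1 − e^{−μ}e^{ix}|²`. [folklore] -/
theorem two_cosh_sub_two_cos_eq_normSq (μ x : ℝ) :
    2 * Real.cosh μ - 2 * Real.cos x =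
      Real.exp μ * Complex.normSq (1 - (Real.exp (-μ) : ℂ) * Complex.exp (x * Complex.I)) := by
  rw [normSq_one_sub_ofReal_mul_exp, Real.cosh_eq]
  have h1 : Real.exp μ * Real.exp (-μ) = 1 := by rw [← Real.exp_add, add_neg_cancel, Real.exp_zero]
  have : Real.exp μ * (1 - 2 * Real.exp (-μ) * Real.cos x + Real.exp (-μ) ^ 2) =
      Real.exp μ - 2 * (Real.exp μ * Real.exp (-μ)) * Real.cos x + (Real.exp μ * Real.exp (-μ)) * Real.exp (-μ) := by ring
  rw [this, h1]; ring

/-- The cyclotomic factorisation at a point: `Π_{j<N} (1 − ζ^j z) = 1 − z^N`, `ζ = e^{2πi/N}`. [folklore] -/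
theorem prod_one_sub_rootOfUnity_pow_mul {N : ℕ} (hN : 0 < N) (z : ℂ) :
    ∏ j ∈ range N, (1 - Complex.exp (2 * Real.pi * Complex.I / N) ^ j * z) = 1 - z ^ N := by
  have hζ : IsPrimitiveRoot (Complex.exp (2 * Real.pi * Complex.I / N)) N := Complex.isPrimitiveRoot_exp N hN.ne'
  have h := X_pow_sub_C_eq_prod hζ hN (rfl : z ^ N = z ^ N)
  have h' := congrArg (Polynomial.eval (1 : ℂ)) h
  simp only [Polynomial.eval_sub, Polynomial.eval_pow, Polynomial.eval_X, Polynomial.eval_C, one_pow,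
    Polynomial.eval_prod] at h'
  rw [h']

/-- ★ **The product formula** `Π_{j<N} (2cosh μ − 2cos(a + 2πj/N)) = 2cosh(Nμ) − 2cos(Na)` (`N ≥ 1`). [folklore] -/
theorem prod_two_cosh_sub_two_cos {N : ℕ} (hN : 0 < N) (μ a : ℝ) :
    ∏ j ∈ range N, (2 * Real.cosh μ - 2 * Real.cos (a + 2 * Real.pi * j / N)) =
      2 * Real.cosh (N * μ) - 2 * Real.cos (N * a) := by
  -- each factor in complex form
  have hfac : ∀ j : ℕ, 2 * Real.cosh μ - 2 * Real.cos (a + 2 * Real.pi * j / N) =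
      Real.exp μ * Complex.normSq (1 - Complex.exp (2 * Real.pi * Complex.I / N) ^ j *
        ((Real.exp (-μ) : ℂ) * Complex.exp (a * Complex.I))) := by
    intro j
    rw [two_cosh_sub_two_cos_eq_normSq]
    congr 2
    rw [← Complex.exp_nat_mul, mul_left_comm, ← Complex.exp_add]
    congr 1
    push_cast
    ring
  rw [prod_congr rfl fun j _ => hfac j, prod_mul_distrib, prod_const, card_range, ← map_prod Complex.normSq,
    prod_one_sub_rootOfUnity_pow_mul hN, mul_pow, ← Complex.ofReal_pow, ← Complex.exp_nat_mul]
  have hx : (N : ℂ) * (a * Complex.I) = ((N * a : ℝ) : ℂ) * Complex.I := by push_cast; ring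
  rw [hx, normSq_one_sub_ofReal_mul_exp, Real.cosh_eq]
  have e0 : Real.exp μ ^ N = Real.exp (N * μ) := by rw [← Real.exp_nat_mul]
  have e1 : Real.exp (-μ) ^ N = Real.exp (-(N * μ)) := by rw [← Real.exp_nat_mul]; ring_nf
  have e2 : Real.exp (N * μ) * Real.exp (-(N * μ)) = 1 := by rw [← Real.exp_add, add_neg_cancel, Real.exp_zero]
  rw [e0, e1]
  have : Real.exp (N * μ) * (1 - 2 * Real.exp (-(N * μ)) * Real.cos (N * a) + Real.exp (-(N * μ)) ^ 2) =
      Real.exp (N * μ) - 2 * (Real.exp (N * μ) * Real.exp (-(N * μ))) * Real.cos (N * a) +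
        (Real.exp (N * μ) * Real.exp (-(N * μ))) * Real.exp (-(N * μ)) := by ring
  rw [this, e2]; ring

/-! ## §2 Twisted massive one-dimensional determinants -/

/-- For a mass `c ≥ 0`: `Π_{j<N} (c + (2 − 2cos(a + 2πj/N))) = 2cosh(N·arcosh(1 + c/2)) − 2cos(Na)`. [folklore] -/
theorem prod_mass_add_twoSubTwoCos_eq {N : ℕ} (hN : 0 < N) {c : ℝ} (hc : 0 ≤ c) (a : ℝ) :
    ∏ j ∈ range N, (c + (2 - 2 * Real.cos (a + 2 * Real.pi * j / N))) =
      2 * Real.cosh (N * Real.arcosh (1 + c / 2)) - 2 * Real.cos (N * a) := by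
  have hμ : 2 * Real.cosh (Real.arcosh (1 + c / 2)) = c + 2 := by
    rw [Real.cosh_arcosh (by linarith)]; ring
  rw [← prod_two_cosh_sub_two_cos hN]
  exact prod_congr rfl fun j _ => by rw [hμ]; ring

/-- ★ **Zero twist minimises the twisted massive 1D determinant**: for `c ≥ 0`,
`Π_{j<N} (c + (2 − 2cos(2πj/N))) ≤ Π_{j<N} (c + (2 − 2cos(a + 2πj/N)))`. [folklore] -/
theorem prod_mass_add_twoSubTwoCos_ge {N : ℕ} (hN : 0 < N) {c : ℝ} (hc : 0 ≤ c) (a : ℝ) :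
    ∏ j ∈ range N, (c + (2 - 2 * Real.cos (2 * Real.pi * j / N))) ≤
      ∏ j ∈ range N, (c + (2 - 2 * Real.cos (a + 2 * Real.pi * j / N))) := by
  have h0 := prod_mass_add_twoSubTwoCos_eq hN hc 0
  simp only [zero_add, mul_zero, Real.cos_zero, mul_one] at h0
  rw [h0, prod_mass_add_twoSubTwoCos_eq hN hc a]
  linarith [Real.cos_le_one (N * a)]

/-- `Fin`-indexed form of `prod_mass_add_twoSubTwoCos_ge`. [folklore] -/
theorem prod_univ_mass_add_twoSubTwoCos_ge {N : ℕ} (hN : 0 < N) {c : ℝ} (hc : 0 ≤ c) (a : ℝ) :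
    ∏ j : Fin N, (c + (2 - 2 * Real.cos (2 * Real.pi * (j : ℕ) / N))) ≤
      ∏ j : Fin N, (c + (2 - 2 * Real.cos (a + 2 * Real.pi * (j : ℕ) / N))) := by
  rw [Fin.prod_univ_eq_prod_range (fun j => c + (2 - 2 * Real.cos (2 * Real.pi * j / N))) N,
    Fin.prod_univ_eq_prod_range (fun j => c + (2 - 2 * Real.cos (a + 2 * Real.pi * j / N))) N]
  exact prod_mass_add_twoSubTwoCos_ge hN hc a

/-- Each factor `c + (2 − 2cos x)` is non-negative for `c ≥ 0`. [folklore] -/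
theorem mass_add_twoSubTwoCos_nonneg {c : ℝ} (hc : 0 ≤ c) (x : ℝ) : 0 ≤ c + (2 - 2 * Real.cos x) := by
  linarith [Real.cos_le_one x]

/-- **The temporal direction**: for `y ≥ 0` and `T ≥ 1`, `Π_{i<T} (2y + (2 − 2cos(2πi/T))) = 2cosh(T·arcosh(1 + y)) − 2` — a zero-point energy
`arcosh(1+y)` is the free energy per unit length of a massive 1D lattice determinant. [folklore] -/
theorem prod_range_twoMul_add_eq {T : ℕ} (hT : 0 < T) {y : ℝ} (hy : 0 ≤ y) :
    ∏ i ∈ range T, (2 * y + (2 - 2 * Real.cos (2 * Real.pi * i / T))) = 2 * Real.cosh (T * Real.arcosh (1 + y)) - 2 := by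
  have h := prod_mass_add_twoSubTwoCos_eq hT (c := 2 * y) (by linarith) 0
  simp only [zero_add, mul_zero, Real.cos_zero, mul_one] at h
  rw [h]; congr 3; ring

/-! ## §3 The transfer trick: determinant inequalities for every temporal length give the zero-point-energy inequality -/

/-- `2cosh x − 2 ≤ e^{x}` for `x ≥ 0`. [folklore] -/
theorem two_cosh_sub_two_le_exp {x : ℝ} (hx : 0 ≤ x) : 2 * Real.cosh x - 2 ≤ Real.exp x := by
  rw [Real.cosh_eq]
  have : Real.exp (-x) ≤ 1 := by rw [Real.exp_le_one_iff]; linarith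
  linarith

/-- `e^{x}/2 ≤ 2cosh x − 2` once `e^{x} ≥ 4`. [folklore] -/
theorem half_exp_le_two_cosh_sub_two {x : ℝ} (hx : 4 ≤ Real.exp x) : Real.exp x / 2 ≤ 2 * Real.cosh x - 2 := by
  rw [Real.cosh_eq]
  linarith [Real.exp_pos (-x)]

/-- `0 ≤ 2cosh x − 2`. [folklore] -/
theorem two_cosh_sub_two_nonneg (x : ℝ) : 0 ≤ 2 * Real.cosh x - 2 := by linarith [Real.one_le_cosh x]

/-- ★ **The transfer trick.**  Let `u ≥ 0` and `ũ > 0` be finite families.  If for every temporal length `T ≥ 1`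
`Π_j (2cosh(T ũ_j) − 2) ≤ Π_j (2cosh(T u_j) − 2)`, then `Σ_j ũ_j ≤ Σ_j u_j` (compare `2^{−n}e^{TΣũ} ≤ Π ≤ Π ≤ e^{TΣu}` for large `T`). [folklore] -/
theorem sum_le_sum_of_prod_cosh_le {ι : Type*} [Fintype ι] {u ut : ι → ℝ} (hu : ∀ j, 0 ≤ u j) (hut : ∀ j, 0 < ut j)
    (H : ∀ T : ℕ, 0 < T → ∏ j, (2 * Real.cosh (T * ut j) - 2) ≤ ∏ j, (2 * Real.cosh (T * u j) - 2)) :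
    ∑ j, ut j ≤ ∑ j, u j := by
  by_contra hlt
  push Not at hlt
  set d : ℝ := ∑ j, ut j - ∑ j, u j with hd
  have hdpos : 0 < d := by rw [hd]; linarith
  set n : ℕ := Fintype.card ι
  -- thresholds
  set A : ℝ := ∑ j, Real.log 4 / ut j with hA
  set B : ℝ := (n * Real.log 2 + 1) / d with hB
  obtain ⟨T, hT⟩ := exists_nat_gt (max (max A B) 1)
  have hT1 : (1 : ℝ) < T := lt_of_le_of_lt (le_max_right _ _) hT
  have hTpos : 0 < T := by exact_mod_cast (zero_lt_one.trans hT1)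
  have hTA : A < T := lt_of_le_of_lt ((le_max_left _ _).trans (le_max_left _ _)) hT
  have hTB : B < T := lt_of_le_of_lt ((le_max_right _ _).trans (le_max_left _ _)) hT
  have hTr : (0 : ℝ) < T := by exact_mod_cast hTpos
  -- each `T ut j ≥ log 4`
  have hlog4 : 0 < Real.log 4 := Real.log_pos (by norm_num)
  have hexp4 : ∀ j, 4 ≤ Real.exp (T * ut j) := by
    intro j
    have h1 : Real.log 4 / ut j ≤ A := by
      rw [hA]
      exact single_le_sum (f := fun j => Real.log 4 / ut j) (fun i _ => div_nonneg hlog4.le (hut i).le) (mem_univ j)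
    have h2 : Real.log 4 / ut j ≤ T := (h1.trans hTA.le)
    have h3 : Real.log 4 ≤ T * ut j := by
      rw [div_le_iff₀ (hut j)] at h2; linarith
    calc (4 : ℝ) = Real.exp (Real.log 4) := by rw [Real.exp_log (by norm_num)]
      _ ≤ Real.exp (T * ut j) := Real.exp_le_exp.mpr h3
  -- lower bound of the `ut` product
  have hlow : Real.exp (T * ∑ j, ut j) / 2 ^ n ≤ ∏ j, (2 * Real.cosh (T * ut j) - 2) := by
    have : Real.exp (T * ∑ j, ut j) / 2 ^ n = ∏ j, (Real.exp (T * ut j) / 2) := by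
      rw [prod_div_distrib, prod_const, card_univ, ← Real.exp_sum, mul_sum]
    rw [this]
    exact prod_le_prod (fun j _ => by positivity) fun j _ => half_exp_le_two_cosh_sub_two (hexp4 j)
  -- upper bound of the `u` product
  have hup : ∏ j, (2 * Real.cosh (T * u j) - 2) ≤ Real.exp (T * ∑ j, u j) := by
    rw [mul_sum, Real.exp_sum]
    exact prod_le_prod (fun j _ => two_cosh_sub_two_nonneg _) fun j _ => two_cosh_sub_two_le_exp (by
      have := hu j; positivity)
  have hchain : Real.exp (T * ∑ j, ut j) / 2 ^ n ≤ Real.exp (T * ∑ j, u j) := hlow.trans ((H T hTpos).trans hup)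
  -- take logarithms
  have h2n : (0 : ℝ) < 2 ^ n := by positivity
  rw [div_le_iff₀ h2n] at hchain
  have hlog := Real.log_le_log (Real.exp_pos _) hchain
  rw [Real.log_exp, Real.log_mul (Real.exp_pos _).ne' h2n.ne', Real.log_exp, Real.log_pow] at hlog
  -- `T d ≤ n log 2` contradicts `T > B`
  have hTd : (T : ℝ) * d ≤ n * Real.log 2 := by rw [hd]; nlinarith
  have hB' : n * Real.log 2 + 1 < T * d := by
    rw [hB, div_lt_iff₀ hdpos] at hTB; linarith
  linarith

end Summit.QuantumFields.YangMills.Theorems.FemtoTransferGap.TwoLattice.Toron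

end
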